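import Summits.CriticalPhenomena.SAWScalingLimit.Theses.SAWRingGibbsDescent

/-!
# Birth skeleton (BC3) of the crux `CommonPinWallContinuity` (stmt-CriticalPhenomena-17607, route
SAWRingGibbsDescent; child 2/3 of `DomainContinuity`, line `common-pin-triangle`)

`CommonPinWallContinuity` compares the critical SAW laws of `W_n` and `W` at the SAME deep pins along a
wall sequence. First cut (lens `strengthen`): replace the sequence by ALL open sets sandwiched in a thin
collar of `W` — the wall structure is used only to put `W_n` in the sandwich.

* `stub_wallTracking` (planar topology of wall-domains, no SAW) — Fréchet convergence of the walls to a
  simple limit wall puts `W_n` in the two-sided `t`-collar sandwich of `W` eventually: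
  `W^{-t} ⊆ W_n ⊆ W^{+t}` (winding number of `∂W_n = η_n ∪ D.arc 1` about points `t`-far from `∂W`);
* `stub_sandwichNoHugging` (the analytic heart: uniform-in-δ NO-HUGGING, sandwich form) — for deep pins the
  critical SAW law of ANY open `V` with `W^{-t} ⊆ V ⊆ W^{+t}` is ε-close to that of `W` once `t ≤ t(s)`,
  `δ < δ₀`: by the exact lattice restriction identity this is `P_V[γ ⊄ U] + P_W[γ ⊄ U] → 0` for a common
  inner domain `U`, whose continuum analogue is the restriction formula with `Φ_{U→V} → id` uniformly in
  the sandwich;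
* `CommonPinWallContinuity_of` — instantiate the sandwich at `V = W_n`, `n ≥ N(t(s))`, marks moved from
  `D` to `W` by `IsWall`.
-/

noncomputable section

namespace Summit.CriticalPhenomena.SAWScalingLimit.Cruxes.CommonPinWallContinuity.Birth

open Filter Topology
open Summit.CriticalPhenomena.SAWScalingLimit.Theses.SAWRingGibbsDescent (CommonPinWallContinuity)

/-- Stub 1: two-sided collar tracking of the wall-domains (inner: the `t`-interior of `W` lies in `W_n`;
outer: `W_n` lies within `t` of `W`), eventually in `n`. [folklore] -/
theorem stub_wallTracking :
    ∀ (D : Literature.Probability.RandomPlanarGeometry.DobrushinDomain), (let IsWall : Literature.Probability.RandomPlanarGeometry.CurveClass ℂ → Literature.Probability.RandomPlanarGeometry.DobrushinDomain → Prop := fun η W => W.carrier ⊆ D.carrier ∧ W.pt 0 = D.pt 0 ∧ W.pt 1 = D.pt 1 ∧ frontier W.carrier = η.range ∪ D.arc 1; ∀ (ηs : ℕ → Literature.Probability.RandomPlanarGeometry.CurveClass ℂ) (η : Literature.Probability.RandomPlanarGeometry.CurveClass ℂ) (Ws : ℕ → Literature.Probability.RandomPlanarGeometry.DobrushinDomain)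 (W : Literature.Probability.RandomPlanarGeometry.DobrushinDomain), (∀ n, IsWall (ηs n) (Ws n)) → IsWall η W → η ∈ Literature.Probability.RandomPlanarGeometry.CurveClass.simple → Filter.Tendsto ηs Filter.atTop (nhds η) → ∀ t > (0 : ℝ), ∃ N : ℕ, ∀ n ≥ N, (∀ z ∈ W.carrier, t ≤ Metric.infDist z W.carrierᶜ → z ∈ (Ws n).carrier) ∧ (∀ z ∈ (Ws n).carrier, Metric.infDist z W.carrier < t)) := by
  sorry

/-- Stub 2: sandwich no-hugging — uniform-in-δ insensitivity of the critical SAW law at `s`-deep pins to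
ANY open perturbation of the domain inside the two-sided `t`-collar, `t = t(f, ε, s)`. [folklore] -/
theorem stub_sandwichNoHugging :
    ∀ (W : Literature.Probability.RandomPlanarGeometry.DobrushinDomain) (f : BoundedContinuousFunction (Literature.Probability.RandomPlanarGeometry.CurveClass ℂ) ℝ), ∀ ε > (0 : ℝ), ∃ ρ : ℝ, 0 < ρ ∧ ∀ s > (0 : ℝ), ∃ t : ℝ, 0 < t ∧ ∃ δ₀ : ℝ, 0 < δ₀ ∧ ∀ δ ∈ Set.Ioo (0 : ℝ) δ₀, ∀ V : Set ℂ, IsOpen V → (∀ z ∈ W.carrier, t ≤ Metric.infDist z W.carrierᶜ → z ∈ V) → (∀ z ∈ V, Metric.infDist z W.carrier < t) → ∀ x y : Literature.Probability.LatticeModels.Site 2, dist (Literature.Probability.LatticeModels.meshPoint δ x) (W.pt 0) < ρ → dist (Literature.Probability.LatticeModels.meshPoint δ y) (W.pt 1) < ρ → Metric.ball (Literature.Probability.LatticeModels.meshPoint δ x) s ⊆ V ∩ W.carrier → Metric.ball (Literature.Probability.LatticeModels.meshPoint δ y) s ⊆ V ∩ W.carrier → (Literature.Probability.LatticeModels.discreteDomainGraph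 V δ).Reachable x y → (Literature.Probability.LatticeModels.discreteDomainGraph W.carrier δ).Reachable x y → |(∫ γ, f γ.curve ∂(Literature.Probability.RandomPlanarGeometry.SAW.law V δ x y)) - ∫ γ, f γ.curve ∂(Literature.Probability.RandomPlanarGeometry.SAW.law W.carrier δ x y)| < ε := by
  sorry

/-! ## Name-keyed aliases (hypotheses of `CommonPinWallContinuity_of`) -/
namespace __Registered

/-- Alias of the statement of `stub_wallTracking`, keyed by the stub name. -/
abbrev stub_wallTracking : Prop :=
  ∀ (D : Literature.Probability.RandomPlanarGeometry.DobrushinDomain), (let IsWall : Literature.Probability.RandomPlanarGeometry.CurveClass ℂ → Literature.Probability.RandomPlanarGeometry.DobrushinDomain → Prop := fun η W => W.carrier ⊆ D.carrier ∧ W.pt 0 = D.pt 0 ∧ W.pt 1 = D.pt 1 ∧ frontier W.carrier = η.range ∪ D.arc 1; ∀ (ηs : ℕ → Literature.Probability.RandomPlanarGeometry.CurveClass ℂ) (η : Literature.Probability.RandomPlanarGeometry.CurveClass ℂ) (Ws : ℕ → Literature.Probability.RandomPlanarGeometry.DobrushinDomain) (W : Literature.Probability.RandomPlanarGeometry.DobrushinDomain),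 (∀ n, IsWall (ηs n) (Ws n)) → IsWall η W → η ∈ Literature.Probability.RandomPlanarGeometry.CurveClass.simple → Filter.Tendsto ηs Filter.atTop (nhds η) → ∀ t > (0 : ℝ), ∃ N : ℕ, ∀ n ≥ N, (∀ z ∈ W.carrier, t ≤ Metric.infDist z W.carrierᶜ → z ∈ (Ws n).carrier) ∧ (∀ z ∈ (Ws n).carrier, Metric.infDist z W.carrier < t))

/-- Alias of the statement of `stub_sandwichNoHugging`, keyed by the stub name. -/
abbrev stub_sandwichNoHugging : Prop :=
  ∀ (W : Literature.Probability.RandomPlanarGeometry.DobrushinDomain) (f : BoundedContinuousFunction (Literature.Probability.RandomPlanarGeometry.CurveClass ℂ) ℝ), ∀ ε > (0 : ℝ), ∃ ρ : ℝ, 0 < ρ ∧ ∀ s > (0 : ℝ), ∃ t : ℝ, 0 < t ∧ ∃ δ₀ : ℝ, 0 < δ₀ ∧ ∀ δ ∈ Set.Ioo (0 : ℝ) δ₀, ∀ V : Set ℂ, IsOpen V → (∀ z ∈ W.carrier, t ≤ Metric.infDist z W.carrierᶜ → z ∈ V) → (∀ z ∈ V, Metric.infDist z W.carrier < t) → ∀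 x y : Literature.Probability.LatticeModels.Site 2, dist (Literature.Probability.LatticeModels.meshPoint δ x) (W.pt 0) < ρ → dist (Literature.Probability.LatticeModels.meshPoint δ y) (W.pt 1) < ρ → Metric.ball (Literature.Probability.LatticeModels.meshPoint δ x) s ⊆ V ∩ W.carrier → Metric.ball (Literature.Probability.LatticeModels.meshPoint δ y) s ⊆ V ∩ W.carrier → (Literature.Probability.LatticeModels.discreteDomainGraph V δ).Reachable x y → (Literature.Probability.LatticeModels.discreteDomainGraph W.carrier δ).Reachable x y → |(∫ γ, f γ.curve ∂(Literature.Probability.RandomPlanarGeometry.SAW.law V δ x y)) - ∫ γ, f γ.curve ∂(Literature.Probability.RandomPlanarGeometry.SAW.law W.carrier δ x y)| < ε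

end __Registered

/-- **Composition** (kernel-checked, no `sorry` of its own): collar tracking puts `W_n` (`n ≥ N(t)`) in the
`t(s)`-sandwich of `W`, where sandwich no-hugging applies with `V = (Ws n).carrier`; the marks of `W` are
those of `D` by `IsWall`. [folklore] -/
theorem CommonPinWallContinuity_of :
    __Registered.stub_wallTracking → __Registered.stub_sandwichNoHugging → CommonPinWallContinuity := by
  intro hT hS D
  dsimp only
  intro ηs η Ws W hWs hW hη hconv f ε hε
  obtain ⟨ρ, hρ, Hρ⟩ := hS W f ε hε
  refine ⟨ρ, hρ, fun s hs => ?_⟩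
  obtain ⟨t, ht, δ₀, hδ₀, H⟩ := Hρ s hs
  have hT1 := hT D
  dsimp only at hT1
  obtain ⟨N, HN⟩ := hT1 ηs η Ws W hWs hW hη hconv t ht
  refine ⟨N, δ₀, hδ₀, ?_⟩
  intro n hn δ hδ x y hx hy hbx hby hRn hRW
  obtain ⟨hin, hout⟩ := HN n hn
  have hW0 : W.pt 0 = D.pt 0 := hW.2.1
  have hW1 : W.pt 1 = D.pt 1 := hW.2.2.1
  have hx' : dist (Literature.Probability.LatticeModels.meshPoint δ x) (W.pt 0) < ρ := by rwa [hW0]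
  have hy' : dist (Literature.Probability.LatticeModels.meshPoint δ y) (W.pt 1) < ρ := by rwa [hW1]
  exact H δ hδ (Ws n).carrier (Ws n).isOpen hin hout x y hx' hy' hbx hby hRn hRW

/-- WIRING CHECK (an `example`, so no pre-composed witness enters the environment). -/
example : CommonPinWallContinuity := CommonPinWallContinuity_of stub_wallTracking stub_sandwichNoHugging

end Summit.CriticalPhenomena.SAWScalingLimit.Cruxes.CommonPinWallContinuity.Birth

end
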